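import Summits.RiemannHypothesis.RiemannHypothesis.Theses.SpectralTrace
import Summits.RiemannHypothesis.RiemannHypothesis.Theorems.SpectralTraceWindowStepConjugateSplit
import Summits.RiemannHypothesis.RiemannHypothesis.Theorems.SpectralTraceWindowStepSaturatedGlue
import Summits.RiemannHypothesis.RiemannHypothesis.Theorems.SpectralTraceWindowStepSharpMultiplicityCap
import Summits.RiemannHypothesis.RiemannHypothesis.Theorems.SpectralTraceWindowStepSaturatedAtoms
import Summits.RiemannHypothesis.RiemannHypothesis.Theorems.SpectralTraceWindowStepStubGapLemma
import Summits.RiemannHypothesis.RiemannHypothesis.Theorems.SpectralTraceWindowStepFirstRungRegular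
import Summits.RiemannHypothesis.RiemannHypothesis.Theorems.SpectralTraceWindowStepConjugateSplitCalibration
import Summits.RiemannHypothesis.RiemannHypothesis.Theorems.SpectralTraceWindowTraceArchStubCountingLaw
import HarnessLib

/-!
# Line `saturated-edge` — birth skeleton for the split child `NoDegenerateEdge`
# (child 2 of the route split `WindowStep ⟸ CrystRegular ∧ NoDegenerateEdge`, route SpectralTrace)

Crux (route decl after the split, FIXED):
`Summit.RiemannHypothesis.RiemannHypothesis.Theses.SpectralTrace.NoDegenerateEdge`
`= ∀ a ≥ (log 3)/2, (∀ B ∈ (0, 2a), Trace(B)) → 0 < ε(a)` — the EDGE horn of the conjugate-point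
dichotomy: a level all of whose lower levels are rungs is never twice a conjugate point of Weil's form
(`ε = weilGroundEnergy`; `Trace(A)`: some real family `γ` reproduces `W = weilFunctional` on the Weil
tests supported in `[-A, A]`).

WHAT IS LANDED (all RH-free; line `conjugate-point` of the parent, leads c3/c4): trace levels are closed
under suprema (`traceClosed`: `stub_traceLimit` p138948 + `stub_traceDilate` p139078), so the hypothesis
puts a rung AT `2a`; Bochner gives `ε(a) ≥ 0`; if `ε(a) = 0` a ground state `u` exists
(`ConnesConsaniMoscovici2025_thm_3_6_holds`) and EVERY atom of the rung is a real zero of `û(1/2+i·)`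
(`stub_groundStateSampling` p138965, `weilMellin_groundState_eq_zero_of_conjugate`): the rung has
COAGULATED onto `Z_ℝ(û)`. First-order counting is exhausted on both sides at the tree's constants:
bounded / little-o multiplicities are excluded (`stub_gapLemma` p139126,
`coagulation_excluded_of_mult_le_log` p139507), the SHARP Christoffel cap
`#{i | γ i = x} ≤ (1/(2a) + η) log|x|` eventually (`ncard_fibre_le_sharp` p142955) makes every density
parameter `δ > 1/(2a)` vacuous, and a violator's log-saturated atoms have linear density
(`saturatedAtoms_linear_density` p143295). So the child REDUCES (landed, `noDegenerateEdge_of_coagulationDense`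
/ `noDegenerateEdge_of_coagulationSaturated`) to: no coagulated rung at a conjugate level `a ≥ (log 3)/2`
(indeed `a > a₁ > (log 3)/2`, `exists_gt_log_three_half_weilGroundEnergy_pos`).

THE CUT registered here = the NEXT RH-free layer named by lead c4 plus the typed Diophantine residual:

1. `stub_realZeroDensity` (RH-FREE, L; Levinson–Cartwright) — the ground-state transform
   `x ↦ û(1/2 + ix)` (entire of exponential type `≤ a`, bounded and square-integrable on `ℝ`, `≢ 0`)
   has at most `(2a/π + η) r` real zeros in `[-r, r]` for `r ≥ r₀(η)` (all its zeros have density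
   `(a′+a″)/π ≤ 2a/π`, `[−a′, a″]` the convex hull of `supp u`). Absent from Mathlib and the tree (the
   tree has only the Jensen slope `2a/log 2`, `exists_card_real_zeros_le`). [Levinson 1940 Ch. III;
   Boas 1954 Thm 8.4.16 / §8.4; Koosis, The Logarithmic Integral I §III.H; Levin 1964 Ch. V]
2. `stub_saturationProfile` (RH-FREE, M) — a COAGULATED level-`2a` family (`a ≥ (log 3)/2`) on the real
   zeros of a ground-state transform obeying the Levinson–Cartwright bound is SATURATED: for every `η > 0`
   and all large `r`, at least `(2a/π − η) r` distinct real zeros `x ∈ [-r, r]` each carry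
   `≥ (1/(2a) − η) log|x|` indices. Proof plan (landed inputs only): total count
   `N_γ(r) = 2θ(r)/π + O(log r) = (r/π) log r − O(r)` (`stub_countingLaw` p-landed for every witness of
   the seed — a level-`2a ≥ log 3` family is one — applied to `γ` and to the reflected family), the sharp
   cap (p142955) bounds each fibre by `(1/(2a)+η₁) log r`, the hypothesis bounds the number of support
   points by `(2a/π+η₂) r`; the budget `N_γ(r) ≤ Σ_{x} mult(x)` then leaves at most `O((η₁+η₂)/η) r`
   under-saturated zeros and forces `≥ (2a/π − O(η)) r` support points.
3. `stub_noSaturatedCrystal` (OPEN, RH-implied — vacuous under RH, no conjugate point; the bet) — at a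
   conjugate level `a ≥ (log 3)/2` (`ε(a) = 0`) no level-`2a` family with a SATURATED PROFILE on the real
   zeros of a ground-state transform exists: the "orthogonal crystal" of the critical Weil–de Branges space
   (all zeros of `û` asymptotically real with the maximal density `2a/π`, i.e. `û(1/2+i·)` of sine type, and
   integer multiplicities equal to the Christoffel values `≍ log|x|/(2a)` along them) is excluded. Second
   order / Diophantine: integrality of the canonical weights of a de Branges space along a density-`2a/π`
   real sequence against the arithmetic of `W` (the prime sum `Σ Λ(m) m^{-1/2} cos(x log m)` sampled on a
   near-arithmetic progression). Generically true (kit j021467: 5/5 synthetic ¬RH worlds die in the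
   INTERIOR, Christoffel readings non-integral by 0.45–0.50); RH-hard exactly in the world `A‡ = 2a⋆`.

Composition `NoDegenerateEdge_of` (pure logic over the three stubs and the landed reduction
`noDegenerateEdge_of_coagulationDense`; no `sorry` outside `stub_*`).

Disproof.lean (parent, v2) honoured: §0 Collapse — the child is crux-implied and RH-implied
(`noDegenerateEdge_of_windowStep'`, landed), jointly with `CrystRegular` worth `WindowTraceArch → RH`
(`riemannHypothesis_of_dichotomy`) and alone NOT (`dichotomy_failure_located`: it fails only in the
edge-death world `ε(A‡/2) = 0`); §2/§5 rigidity lemmas (Nested/FiniteMoves/BothWays/BelowHeight) are not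
engaged — no stub edits a family; the coagulated rung is the extreme instance of BothWays. No stub is an
instance of a landed Negative lemma: UnitMass `norm_sq_le_of_windowTrace` is the kernel instance of the
sampling identity behind stub 2's cap; LocalWeyl/RungCorridor feed the counting in stub 2.
-/

set_option linter.dupNamespace false

noncomputable section

open Complex Set Filter
open scoped Topology

namespace Summit.RiemannHypothesis.RiemannHypothesis.Cruxes.NoDegenerateEdge.SaturatedEdge

open Literature.NumberTheory.LFunctions
open Summit.RiemannHypothesis.RiemannHypothesis.Theses.SpectralTrace
open Summit.RiemannHypothesis.RiemannHypothesis.Theorems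
open Summit.RiemannHypothesis.RiemannHypothesis.Theorems.SpectralTraceWindowStep
open Summit.RiemannHypothesis.RiemannHypothesis.Theorems.WindowStep.Negative
open Summit.RiemannHypothesis.RiemannHypothesis.Theorems.WeilWindowFlowGronwallLeakage

/-- File-local spelling of `Trace(A)` (verbatim the shape of the route decls). -/
local notation3 "WTrace " A:max => ∃ (ι : Type) (γ : ι → ℝ), ∀ g : ℝ → ℂ, IsWeilTest g →
  tsupport g ⊆ Set.Icc (-A) A →
    HasSum (fun i => weilMellin g (1 / 2 + (γ i : ℂ) * I)) (weilFunctional g)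

/-! ## Vocabulary (definitions only) -/

/-- **Levinson–Cartwright upper real-zero density** of the transform `x ↦ û(1/2 + ix)`: every finite set
of its real zeros in `[-r, r]` has at most `(2a/π + η) r` elements once `r ≥ r₀(η)`. -/
def RealZeroDensityLe (a : ℝ) (u : ℝ → ℂ) : Prop :=
  ∀ η : ℝ, 0 < η → ∃ r₀ : ℝ, ∀ r : ℝ, r₀ ≤ r → ∀ Z : Finset ℝ,
    (∀ x ∈ Z, |x| ≤ r ∧ weilMellin u (1 / 2 + (x : ℂ) * I) = 0) →
      (Z.card : ℝ) ≤ (2 * a / Real.pi + η) * r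

/-- **Saturated profile** of a family `γ` on the real zeros of `û`: for every `η > 0` and all large `r`,
at least `(2a/π − η) r` distinct real zeros `x` of `û(1/2+i·)` in `[-r, r]` each carry at least
`(1/(2a) − η) log|x|` indices of `γ` (cap-saturating atoms have the full linear density). -/
def SaturatedProfile (a : ℝ) (u : ℝ → ℂ) {ι : Type} (γ : ι → ℝ) : Prop :=
  ∀ η : ℝ, 0 < η → ∃ r₀ : ℝ, ∀ r : ℝ, r₀ ≤ r → ∃ Z : Finset ℝ,
    (∀ x ∈ Z, |x| ≤ r ∧ weilMellin u (1 / 2 + (x : ℂ) * I) = 0 ∧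
      (1 / (2 * a) - η) * Real.log |x| ≤ ({i : ι | γ i = x}.ncard : ℝ)) ∧
    (2 * a / Real.pi - η) * r ≤ (Z.card : ℝ)

/-- The child, spelled out (verbatim the route decl `SpectralTrace.NoDegenerateEdge`). -/
def NoDegenerateEdgeStatement : Prop :=
  ∀ a : ℝ, Real.log 3 / 2 ≤ a → (∀ B : ℝ, 0 < B → B < 2 * a → WTrace B) → 0 < weilGroundEnergy a

/-! ## THE REGISTERED STUBS (`sorry` lives only here) -/

/-- **stub_realZeroDensity (RH-FREE, L; Levinson–Cartwright for ground-state transforms).** For a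
ground state `u` of the window `[-a, a]` (`MemLp u 2`, `L²`-limit of unit tests supported in `[-a, a]`,
so `û(1/2+i·)` is entire of exponential type `≤ a`, bounded by `‖u‖₁` and square-integrable on `ℝ`,
`≢ 0` by `exists_weilMellin_half_line_ne_zero`), the real zeros have upper density `≤ 2a/π`:
`#(Z ∩ [-r, r]) ≤ (2a/π + η) r` for every finite set `Z` of real zeros, `r ≥ r₀(u, η)`. (All zeros of a
Cartwright-class function of type `a` have density `(h(π/2)+h(−π/2))/(2π)·2 ≤ 2a/π`, asymptotically
symmetric and clustering to the real axis; the real ones are a subset.) [Levinson 1940, Gap and Density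
Theorems, Ch. III; Boas 1954, Entire Functions, §8.4; Koosis 1988, The Logarithmic Integral I, §III.H.2] -/
theorem stub_realZeroDensity :
    ∀ a : ℝ, 0 < a → ∀ u : ℝ → ℂ, Literature.NumberTheory.LFunctions.IsWeilGroundState a u →
      ∀ η : ℝ, 0 < η → ∃ r₀ : ℝ, ∀ r : ℝ, r₀ ≤ r → ∀ Z : Finset ℝ,
        (∀ x ∈ Z, |x| ≤ r ∧
          Literature.NumberTheory.LFunctions.weilMellin u (1 / 2 + (x : ℂ) * Complex.I) = 0) →
          (Z.card : ℝ) ≤ (2 * a / Real.pi + η) * r := by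
  sorry

/-- **stub_saturationProfile (RH-FREE, M; the counting budget closes).** Let `a ≥ (log 3)/2`, `u` a
ground state of `[-a, a]` whose transform obeys the Levinson–Cartwright bound, and `γ` a level-`2a`
family lying INSIDE the real zero set of `û(1/2+i·)`. Then `γ` has a saturated profile on those zeros.
Inputs, all landed: the counting law `#{i : γ i ∈ [0, T]} = θ(T)/π + O(log(1+T))`
(`SpectralTraceWindowTraceArch.stub_countingLaw`, for every witness of the seed — `γ` and its reflection
are, `2a ≥ log 3 > log 2`, `windowTrace_anti`), the sharp cap `ncard_fibre_le_sharp` (p142955), local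
finiteness (`card_near_le_log_of_windowTrace`); then the budget
`(r/π) log r − O(r) ≤ N_γ(r) = Σ_{x ∈ Z_r} mult(x) ≤ #Z_r · (1/(2a)+η₁) log r − #U_r · (η+η₁) log r + O(1)`
with `#Z_r ≤ (2a/π + η₂) r` bounds the under-saturated positions `#U_r ≤ O((η₁ + η₂/a)/(η+η₁)) r` and
forces `#Z_r ≥ (2a/π)(1 − O(aη₁)) r − o(r)`. -/
theorem stub_saturationProfile :
    ∀ a : ℝ, Real.log 3 / 2 ≤ a → ∀ u : ℝ → ℂ, Literature.NumberTheory.LFunctions.IsWeilGroundState a u →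
      (∀ η : ℝ, 0 < η → ∃ r₀ : ℝ, ∀ r : ℝ, r₀ ≤ r → ∀ Z : Finset ℝ,
        (∀ x ∈ Z, |x| ≤ r ∧
          Literature.NumberTheory.LFunctions.weilMellin u (1 / 2 + (x : ℂ) * Complex.I) = 0) →
          (Z.card : ℝ) ≤ (2 * a / Real.pi + η) * r) →
      ∀ (ι : Type) (γ : ι → ℝ),
        (∀ g : ℝ → ℂ, Literature.NumberTheory.LFunctions.IsWeilTest g →
          tsupport g ⊆ Set.Icc (-(2 * a)) (2 * a) →
            HasSum (fun i => Literature.NumberTheory.LFunctions.weilMellin g (1 / 2 + (γ i : ℂ) * Complex.I))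
              (Literature.NumberTheory.LFunctions.weilFunctional g)) →
        (∀ i : ι, Literature.NumberTheory.LFunctions.weilMellin u (1 / 2 + (γ i : ℂ) * Complex.I) = 0) →
        ∀ η : ℝ, 0 < η → ∃ r₀ : ℝ, ∀ r : ℝ, r₀ ≤ r → ∃ Z : Finset ℝ,
          (∀ x ∈ Z, |x| ≤ r ∧
            Literature.NumberTheory.LFunctions.weilMellin u (1 / 2 + (x : ℂ) * Complex.I) = 0 ∧
            (1 / (2 * a) - η) * Real.log |x| ≤ ({i : ι | γ i = x}.ncard : ℝ)) ∧
          (2 * a / Real.pi - η) * r ≤ (Z.card : ℝ) := by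
  sorry

/-- **stub_noSaturatedCrystal (OPEN, RH-implied; HARDEST — the typed Diophantine residual of the edge
horn).** At a conjugate level `a ≥ (log 3)/2` (`ε(a) = 0`; none exists `≤ a₁` for some `a₁ > (log 3)/2`,
`exists_gt_log_three_half_weilGroundEnergy_pos`; at most one, strict antitonicity) no real family
reproducing `W` on the Weil tests of `[-2a, 2a]` has a SATURATED PROFILE on the real zeros of a
ground-state transform `û(1/2+i·)`: the orthogonal crystal of the critical Weil–de Branges space — `û` of
sine type with all zeros asymptotically real at the maximal density `2a/π`, the family sitting on them with
integer multiplicities equal to the Christoffel values `(1+o(1)) log|x|/(2a)` — does not exist. Vacuous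
under RH (no conjugate point: `coagulationDense_of_riemannHypothesis` pattern); implied by the child (a
rung at `2a` with `ε(a) = 0` contradicts it); in the threshold model of `WindowTraceArch ∧ ¬RH` it fails
iff the integer ladder dies EXACTLY at the conjugate level (`A‡ = 2a⋆`). Handles: de Branges Thm 22
(orthogonal sampling sets and their canonical weights `π/(φ′(x)|E(x)|²)`), the explicit arithmetic of `W`
on `(−2a, 2a)` (finite prime sum) sampled along a near-arithmetic progression, and the kit lab j021467
(edge autopsy: Christoffel readings at the null ground state's real zeros). -/
theorem stub_noSaturatedCrystal :
    ∀ a : ℝ, Real.log 3 / 2 ≤ a → Literature.NumberTheory.LFunctions.weilGroundEnergy a = 0 →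
      ∀ u : ℝ → ℂ, Literature.NumberTheory.LFunctions.IsWeilGroundState a u →
        ∀ (ι : Type) (γ : ι → ℝ),
          (∀ g : ℝ → ℂ, Literature.NumberTheory.LFunctions.IsWeilTest g →
            tsupport g ⊆ Set.Icc (-(2 * a)) (2 * a) →
              HasSum (fun i => Literature.NumberTheory.LFunctions.weilMellin g (1 / 2 + (γ i : ℂ) * Complex.I))
                (Literature.NumberTheory.LFunctions.weilFunctional g)) →
          (∀ η : ℝ, 0 < η → ∃ r₀ : ℝ, ∀ r : ℝ, r₀ ≤ r → ∃ Z : Finset ℝ,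
            (∀ x ∈ Z, |x| ≤ r ∧
              Literature.NumberTheory.LFunctions.weilMellin u (1 / 2 + (x : ℂ) * Complex.I) = 0 ∧
              (1 / (2 * a) - η) * Real.log |x| ≤ ({i : ι | γ i = x}.ncard : ℝ)) ∧
            (2 * a / Real.pi - η) * r ≤ (Z.card : ℝ)) →
          ∃ i : ι, Literature.NumberTheory.LFunctions.weilMellin u (1 / 2 + (γ i : ℂ) * Complex.I) ≠ 0 := by
  sorry

/-! ## Name-keyed aliases (the hypotheses of the composition) -/
namespace Registered

/-- Alias keyed by the registered stub name. -/
abbrev stub_realZeroDensity : Prop :=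
  ∀ a : ℝ, 0 < a → ∀ u : ℝ → ℂ, IsWeilGroundState a u → RealZeroDensityLe a u
/-- Alias keyed by the registered stub name. -/
abbrev stub_saturationProfile : Prop :=
  ∀ a : ℝ, Real.log 3 / 2 ≤ a → ∀ u : ℝ → ℂ, IsWeilGroundState a u → RealZeroDensityLe a u →
    ∀ (ι : Type) (γ : ι → ℝ),
      (∀ g : ℝ → ℂ, IsWeilTest g → tsupport g ⊆ Set.Icc (-(2 * a)) (2 * a) →
        HasSum (fun i => weilMellin g (1 / 2 + (γ i : ℂ) * I)) (weilFunctional g)) →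
      (∀ i : ι, weilMellin u (1 / 2 + (γ i : ℂ) * I) = 0) → SaturatedProfile a u γ
/-- Alias keyed by the registered stub name. -/
abbrev stub_noSaturatedCrystal : Prop :=
  ∀ a : ℝ, Real.log 3 / 2 ≤ a → weilGroundEnergy a = 0 → ∀ u : ℝ → ℂ, IsWeilGroundState a u →
    ∀ (ι : Type) (γ : ι → ℝ),
      (∀ g : ℝ → ℂ, IsWeilTest g → tsupport g ⊆ Set.Icc (-(2 * a)) (2 * a) →
        HasSum (fun i => weilMellin g (1 / 2 + (γ i : ℂ) * I)) (weilFunctional g)) →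
      SaturatedProfile a u γ → ∃ i : ι, weilMellin u (1 / 2 + (γ i : ℂ) * I) ≠ 0

end Registered

/-! ## Consistency: each alias IS its registered stub (definitionally) -/

theorem realZeroDensity_holds : Registered.stub_realZeroDensity := stub_realZeroDensity
theorem saturationProfile_holds : Registered.stub_saturationProfile := stub_saturationProfile
theorem noSaturatedCrystal_holds : Registered.stub_noSaturatedCrystal := stub_noSaturatedCrystal

/-! ## Kernel-checked glue (no `sorry` below this line) -/

/-- **No coagulated rung at a conjugate level** from the three stubs: a level-`2a` family inside
`Z_ℝ(û)` at `a ≥ (log 3)/2`, `ε(a) = 0`, would be saturated (stubs 1+2) and then stub 3 produces an atom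
off `Z_ℝ(û)`. -/
theorem exists_weilMellin_ne_zero_of_stubs (h₁ : Registered.stub_realZeroDensity)
    (h₂ : Registered.stub_saturationProfile) (h₃ : Registered.stub_noSaturatedCrystal)
    {a : ℝ} (ha : Real.log 3 / 2 ≤ a) (h0 : weilGroundEnergy a = 0) {u : ℝ → ℂ}
    (hu : IsWeilGroundState a u) {ι : Type} {γ : ι → ℝ}
    (hγ : ∀ g : ℝ → ℂ, IsWeilTest g → tsupport g ⊆ Set.Icc (-(2 * a)) (2 * a) →
      HasSum (fun i => weilMellin g (1 / 2 + (γ i : ℂ) * I)) (weilFunctional g)) :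
    ∃ i : ι, weilMellin u (1 / 2 + (γ i : ℂ) * I) ≠ 0 := by
  by_contra hnone
  push Not at hnone
  have hapos : 0 < a := lt_of_lt_of_le (by positivity) ha
  have hprof : SaturatedProfile a u γ := h₂ a ha u hu (h₁ a hapos u hu) ι γ hγ hnone
  obtain ⟨i, hi⟩ := h₃ a ha h0 u hu ι γ hγ hprof
  exact hi (hnone i)

/-- **THE LINE CONCLUDES THE CHILD** (pure logic over the three registered stubs, through the landed
reduction `noDegenerateEdge_of_coagulationDense`, whose density hypotheses are not even needed). -/
theorem noDegenerateEdge_of (h₁ : Registered.stub_realZeroDensity)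
    (h₂ : Registered.stub_saturationProfile) (h₃ : Registered.stub_noSaturatedCrystal) :
    NoDegenerateEdgeStatement :=
  noDegenerateEdge_of_coagulationDense fun _ ha h0 _ hu _ _ _ _ _ hγ =>
    exists_weilMellin_ne_zero_of_stubs h₁ h₂ h₃ ha h0 hu hγ

/-- **The child BY ITS VERBATIM STATEMENT** (the route decl `SpectralTrace.NoDegenerateEdge` after the
split is this term; see `NoDegenerateEdge_of` below once the gate has written it). -/
theorem NoDegenerateEdge_of_stubs (h₁ : Registered.stub_realZeroDensity)
    (h₂ : Registered.stub_saturationProfile) (h₃ : Registered.stub_noSaturatedCrystal) :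
    ∀ a : ℝ, Real.log 3 / 2 ≤ a →
      (∀ B : ℝ, 0 < B → B < 2 * a →
        ∃ (ι : Type) (γ : ι → ℝ), ∀ g : ℝ → ℂ, Literature.NumberTheory.LFunctions.IsWeilTest g →
          tsupport g ⊆ Set.Icc (-B) B →
            HasSum (fun i => Literature.NumberTheory.LFunctions.weilMellin g (1 / 2 + (γ i : ℂ) * Complex.I))
              (Literature.NumberTheory.LFunctions.weilFunctional g)) →
      0 < Literature.NumberTheory.LFunctions.weilGroundEnergy a :=
  noDegenerateEdge_of h₁ h₂ h₃

/-! ### By-name conclusion (activate once the gate has written the child decl)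
After `route edit --split WindowStep --into children.json --glue-by …windowStep_of_dichotomy` the route
file carries `def NoDegenerateEdge : Prop := <the verbatim statement above>`; then this declaration (definitional
unfolding only) is appended and the file is registered with
`ledger skeleton check $(ledger crux dir <child-item>)/Lines/<slug>.lean --crux <child-item>`:

    theorem NoDegenerateEdge_of (h₁ : Registered.stub_realZeroDensity) (h₂ : Registered.stub_saturationProfile) (h₃ : Registered.stub_noSaturatedCrystal) :
        Summit.RiemannHypothesis.RiemannHypothesis.Theses.SpectralTrace.NoDegenerateEdge :=
      noDegenerateEdge_of h₁ h₂ h₃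
-/

/-- **Where the child sits (informational, sorry-free):** with the sibling child `CrystRegular` of the
split (verbatim), the child closes the PARENT crux `WindowStep` by the landed glue
`windowStep_of_dichotomy` (p140332). Not a stub of this line. -/
theorem windowStep_of_sibling_and_child
    (hR : ∀ B : ℝ, Real.log 2 ≤ B →
      Summit.RiemannHypothesis.RiemannHypothesis.Theses.SpectralTrace.WindowTraceArch →
        0 < Literature.NumberTheory.LFunctions.weilGroundEnergy (B / 2) →
          ∃ (ι : Type) (γ : ι → ℝ), ∀ g : ℝ → ℂ, Literature.NumberTheory.LFunctions.IsWeilTest g →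
            tsupport g ⊆ Set.Icc (-B) B →
              HasSum (fun i => Literature.NumberTheory.LFunctions.weilMellin g (1 / 2 + (γ i : ℂ) * Complex.I))
                (Literature.NumberTheory.LFunctions.weilFunctional g))
    (hE : NoDegenerateEdgeStatement) :
    Summit.RiemannHypothesis.RiemannHypothesis.Theses.SpectralTrace.WindowStep :=
  windowStep_of_dichotomy hR hE


/-! ## Calibration (sorry-free): honesty of the stubs -/

/-- Stub 3 is RH-IMPLIED — vacuous under RH: `ε(a) > 0` at every window. -/
theorem noSaturatedCrystal_of_riemannHypothesis (hRH : _root_.RiemannHypothesis) :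
    Registered.stub_noSaturatedCrystal := by
  intro a ha h0
  exfalso
  have hapos : 0 < a := lt_of_lt_of_le (by positivity) ha
  have hpos : WeilPositivityOn (a + 1) :=
    WeilPositivityOn.of_riemannHypothesis explicit_formula_holds hRH (a + 1)
  have := weilGroundEnergy_pos_of_weilPositivityOn_of_lt hpos hapos (by linarith)
  linarith

/-- Stub 3 is CHILD-IMPLIED (nothing registered is stronger than the child): a level-`2a` family makes
every level below `2a` a rung (`windowTrace_anti`), so the child gives `0 < ε(a)`, contradicting
`ε(a) = 0`. -/
theorem noSaturatedCrystal_of_child (h : NoDegenerateEdgeStatement) :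
    Registered.stub_noSaturatedCrystal := by
  intro a ha h0 u _ ι γ hγ _
  exfalso
  have hbelow : ∀ B : ℝ, 0 < B → B < 2 * a → WTrace B :=
    fun B _ hB => windowTrace_anti hB.le ⟨ι, γ, hγ⟩
  have := h a ha hbelow
  linarith

/-- Stub 3 is needed only strictly above Yoshida's certified range: for `a ≤ (log 3)/2` there is no
conjugate point (`weilGroundEnergy_pos_of_le_log_three_half`, p141362), indeed none `≤ a₁` for some
`a₁ > (log 3)/2`. -/
theorem no_conjugate_point_le_log_three_half {a : ℝ} (ha : 0 < a) (h : a ≤ Real.log 3 / 2) :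
    weilGroundEnergy a ≠ 0 :=
  (weilGroundEnergy_pos_of_le_log_three_half ha h).ne'

end Summit.RiemannHypothesis.RiemannHypothesis.Cruxes.NoDegenerateEdge.SaturatedEdge

end
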